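import Literature.Computability.AlgebraicComplexity.BorderRankMatMulRectangular
import Literature.Computability.AlgebraicComplexity.LandsbergMichalekSubstitution
import HarnessLib

/-!
# Lickteig's increment `R̲(M_⟨l+1,m,n⟩) ≥ R̲(M_⟨l,m,n⟩) + 1`: proved (border substitution)

Topic `Literature/Computability/AlgebraicComplexity`; the `…Proofs`-style companion of
`BorderRankMatMulRectangular.lean` for the named facts quoting Lickteig's 1984 note through
Conner–Harper–Landsberg 2023, §9 (p. 18): "Proof that `R̲(M_⟨l,m,n⟩) ≥ R̲(M_⟨l−1,m,n⟩) + 1`. Here is a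
simple proof of the statement, which was originally shown in [Lickteig 1984]. By the border substitution
method [Landsberg–Michałek], for any tensor `T ∈ A ⊗ B ⊗ C`, `R̲(T) ≥ min_{A' ⊂ A*} R̲(T|_{A'⊗B*⊗C*}) + 1`
where `A' ⊂ A*` is a hyperplane […] we may degenerate this tensor further to set all `xⁱ_l` and `y^l_j`
to zero to obtain the result."  Everything here is PROVED, over `K[ε]` and WITHOUT limits or orbit
closures: the tree's border substitution lemma `IsApproxDecomposition.substitute`
(`LandsbergMichalekSubstitution.lean`, LM18 Prop. 2.3 made algebraic) produces, from an optimal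
approximate decomposition of `t` with `r + 1` triads, a non-zero vector `x ∈ K^ι` (the trailing
coefficient vector of one `A`-leg) such that EVERY linear substitution `Φ : K^ι → K^{ι'}` with
`Φ x = 0` gives `R_h(Φ·t) ≤ r` (`exists_approxRank_restrict₁_le`, `exists_algBorderRank_restrict₁_le`:
`Φ = ℓ(x)⁻¹ · Φ ∘ (ℓ(x)·1 − x ⊗ ℓ)` for a coordinate functional `ℓ` with `ℓ(x) ≠ 0`).  For
`t = M_⟨l+1,m,n⟩` with the FIRST slot the entries of `Z = XY` (an `(l+1) × n` matrix), pick an entry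
`(i,u₀)` with `x_{i,u₀} ≠ 0`; the substitution `lickteigSubst` deletes the `Z`-row `i`, corrected along
the coordinate `(i,u₀)` so as to kill `x`; since the `X`-rows `≠ i` never meet the `Z`-row `i`, the
substituted tensor restricted to the `X`-rows `≠ i` IS `M_⟨l,m,n⟩` (`lickteigSubst_matMulTensor`) — no
degeneration argument is needed. Hence:

* `Lickteig1984_borderRank_matMulTensor_succ_holds` — discharge of the named fact
  `Lickteig1984_borderRank_matMulTensor_succ` (`R̲(⟨l,m,n⟩) + 1 ≤ R̲(⟨l+1,m,n⟩)`, `l, m, n ≥ 1`, over `ℂ`;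
  the proof works over every field, `algBorderRank_matMulTensor_succ_le`);
* `Lickteig1984_borderRank_matMulTensor_2nn_holds` (`n² + 1 ≤ R̲(M_⟨2,n,n⟩)`, `n ≥ 2`) and
  `Lickteig1984_borderRank_matMulTensor_3nn_holds` (`n² + 2 ≤ R̲(M_⟨3,n,n⟩)`, `n ≥ 4`) — the increment
  iterated from the flattening bound `n·n ≤ R̲(M_⟨1,n,n⟩)` (`mul_le_algBorderRank_matMulTensor_right`);
* `ConnerHarperLandsberg2023_cor_1_7_of_thm_1_5` — CHL Cor. 1.7 now conditional on Thm. 1.5(3) alone.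

## References

* [Lickteig1984] T. Lickteig, *A note on border rank*, Inform. Process. Lett. 18 (1984) 173–178 — main
  result, as reproved in CHL 2023 §9.
* [ConnerHarperLandsberg2023] A. Conner, A. Harper, J. M. Landsberg, *New lower bounds for matrix
  multiplication and det₃*, Forum Math. Pi 11 (2023) e17 = arXiv:1911.07981 — §9 (p. 18) (held:
  paper:arxiv-1911.07981, chunk 18).
* [LandsbergMichalek2018] J. M. Landsberg, M. Michałek, IMRN 2018 (15) 4722–4733 = arXiv:1608.07486 —
  Prop. 2.3 (border substitution), in tree `LandsbergMichalekSubstitution.lean`.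
-/

noncomputable section

open scoped BigOperators Polynomial
open Polynomial

namespace Literature.Computability.AlgebraicComplexity

universe u v₁ v₂ v₃ v₄

/-! ## Border substitution for an arbitrary substitution killing the trailing vector -/

section Substitution

variable {K : Type u} [Field K]
variable {ι : Type v₁} {κ : Type v₂} {μ : Type v₃} {ι' : Type v₄}
variable [Fintype ι] [Fintype κ] [Fintype μ] [DecidableEq ι] [DecidableEq κ] [DecidableEq μ]

/-- `R_h(Φ·t) ≤ R_h(t)` for a linear substitution `Φ` in the first slot (the `R_h` form of
`algBorderRank_restrict₁_le`). [cite: ConnerGesmundoLandsbergVentura2022, §1.1 (restriction monotonicity)] -/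
theorem approxRank_restrict₁_le (h : ℕ) (t : ι → κ → μ → K) (Φ : ι' → ι → K) :
    approxRank h (fun a' b c => ∑ a, Φ a' a * t a b c) ≤ approxRank h t := by
  refine TensorRestrictsTo.approxRank_le ⟨Φ, fun b' b => if b = b' then 1 else 0,
    fun c' c => if c = c' then 1 else 0, fun a' b' c' => ?_⟩ h
  refine Finset.sum_congr rfl fun a _ => ?_
  rw [Finset.sum_eq_single b' (fun b _ hb => by simp [hb]) (by simp),
    Finset.sum_eq_single c' (fun c _ hc => by simp [hc]) (by simp)]
  simp

/-- **Border substitution, every substitution killing the trailing vector** (CHL 2023 §9 /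
Landsberg–Michałek Prop. 2.3, algebraic form): if `t` has an order-`h` approximate decomposition with
`r + 1` triads, there is a non-zero `x ∈ K^ι` such that `R_h(Φ·t) ≤ r` for every linear substitution
`Φ : K^ι → K^{ι'}` in the first slot with `Φ x = 0`.  (`x` = trailing coefficient vector of the first
`A`-leg; if that leg vanishes, any non-zero `x` works.) [cite: ConnerHarperLandsberg2023, §9 (p. 18)]
[cite: LandsbergMichalek2018, Prop. 2.3 (border substitution)] -/
theorem exists_approxRank_restrict₁_le [Nonempty ι] {h r : ℕ} {t : ι → κ → μ → K}
    {u : Fin (r + 1) → ι → K[X]} {v : Fin (r + 1) → κ → K[X]} {w : Fin (r + 1) → μ → K[X]}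
    (H : IsApproxDecomposition h t u v w) :
    ∃ x : ι → K, x ≠ 0 ∧ ∀ Φ : ι' → ι → K, (∀ a', ∑ a, Φ a' a * x a = 0) →
      approxRank h (fun a' b c => ∑ a, Φ a' a * t a b c) ≤ r := by
  classical
  by_cases h0 : u 0 = 0
  · -- the first triad is zero: drop it
    obtain ⟨i⟩ := ‹Nonempty ι›
    refine ⟨Pi.single i 1, fun hz => by simpa using congr_fun hz i, fun Φ _ => ?_⟩
    have H' : IsApproxDecomposition h t (fun ρ => u ρ.succ) (fun ρ => v ρ.succ)
        (fun ρ => w ρ.succ) := by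
      intro a b c j hj
      have := H a b c j hj
      rw [Fin.sum_univ_succ] at this
      simpa [h0] using this
    exact (approxRank_restrict₁_le h t Φ).trans (approxRank_le_of_isApproxDecomposition H')
  · obtain ⟨s, ut, hu, aS, haS⟩ := exists_X_pow_mul_of_ne_zero (u 0) h0
    set x : ι → K := fun a => (ut a).coeff 0 with hx
    refine ⟨x, fun hz => haS (by simpa [hx] using congr_fun hz aS), fun Φ hΦ => ?_⟩
    -- substitute with the coordinate functional `ℓ = e^{aS}`: `ℓ(x) = x aS ≠ 0`
    have HS := H.substitute 0 hu (Pi.single aS 1)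
    have hℓ : ∀ f : ι → K, ∑ a', (Pi.single aS (1 : K) : ι → K) a' * f a' = f aS := fun f => by
      simp [Pi.single_apply]
    simp only [hℓ] at HS
    -- `Φ·t = (x aS)⁻¹ Φ · ((x aS) t − x ⊗ t(aS,·,·))` because `Φ x = 0`
    have key : (fun a' b c => ∑ a, Φ a' a * t a b c) = fun a' b c =>
        ∑ a, ((x aS)⁻¹ * Φ a' a) * ((ut aS).coeff 0 * t a b c - (ut a).coeff 0 * t aS b c) := by
      funext a' b c
      have hz : ∑ a, Φ a' a * (ut a).coeff 0 = 0 := hΦ a'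
      have e1 : ∑ a, ((x aS)⁻¹ * Φ a' a) * ((ut aS).coeff 0 * t a b c - (ut a).coeff 0 * t aS b c) =
          (x aS)⁻¹ * (x aS) * ∑ a, Φ a' a * t a b c -
            (x aS)⁻¹ * (∑ a, Φ a' a * (ut a).coeff 0) * t aS b c := by
        rw [Finset.mul_sum, Finset.mul_sum, Finset.sum_mul, ← Finset.sum_sub_distrib]
        exact Finset.sum_congr rfl fun a _ => by simp only [hx]; ring
      rw [e1, hz, inv_mul_cancel₀ haS]
      ring
    rw [key]
    exact (approxRank_restrict₁_le h _ _).trans (approxRank_le_of_isApproxDecomposition HS)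

/-- The border-rank form: if `bR(t) = r + 1` there is a non-zero `x ∈ K^ι` with `bR(Φ·t) ≤ r` for
every first-slot substitution `Φ` killing `x` ("`R̲(T) ≥ min_{A'} R̲(T|_{A'⊗B*⊗C*}) + 1`", CHL §9).
[cite: ConnerHarperLandsberg2023, §9 (p. 18)] [cite: LandsbergMichalek2018, Prop. 2.3] -/
theorem exists_algBorderRank_restrict₁_le [Nonempty ι] {r : ℕ} (t : ι → κ → μ → K)
    (hr : algBorderRank t = r + 1) :
    ∃ x : ι → K, x ≠ 0 ∧ ∀ Φ : ι' → ι → K, (∀ a', ∑ a, Φ a' a * x a = 0) →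
      algBorderRank (fun a' b c => ∑ a, Φ a' a * t a b c) ≤ r := by
  obtain ⟨h₀, hh₀⟩ := exists_algBorderRank_eq_approxRank t
  have hex : ∃ (u : Fin (r + 1) → ι → K[X]) (v : Fin (r + 1) → κ → K[X])
      (w : Fin (r + 1) → μ → K[X]), IsApproxDecomposition h₀ t u v w := by
    rw [← hr, hh₀]
    exact exists_isApproxDecomposition_approxRank h₀ t
  obtain ⟨u, v, w, H⟩ := hex
  obtain ⟨x, hx, hΦ⟩ := exists_approxRank_restrict₁_le (ι' := ι') H
  exact ⟨x, hx, fun Φ hz => (algBorderRank_le_approxRank h₀ _).trans (hΦ Φ hz)⟩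

end Substitution

/-! ## The substitution deleting a row of `Z = XY` -/

section MatMul

variable (K : Type u) [Field K]

/-- The first-slot substitution `K^{(l+1) × n} → K^{l × n}` deleting the `Z`-row `i`, corrected along
the coordinate `(i, u₀)` so that it kills `x` (requires `x (i,u₀) ≠ 0`):
`e_{(I,u)} ↦ e_{(σᵢ I, u)} − (x_{σᵢ I,u} / x_{i,u₀}) e_{(i,u₀)}` (`σᵢ = Fin.succAbove i`).
[cite: ConnerHarperLandsberg2023, §9 (p. 18)] -/
def lickteigSubst (l n : ℕ) (x : Fin (l + 1) × Fin n → K) (i : Fin (l + 1)) (u₀ : Fin n)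
    (c' : Fin l × Fin n) (c : Fin (l + 1) × Fin n) : K :=
  (if ((i.succAbove c'.1, c'.2) : Fin (l + 1) × Fin n) = c then 1 else 0) -
    if c = (i, u₀) then x (i.succAbove c'.1, c'.2) / x (i, u₀) else 0

/-- `lickteigSubst` kills `x`. [cite: ConnerHarperLandsberg2023, §9 (p. 18)] -/
theorem lickteigSubst_apply_self (l n : ℕ) (x : Fin (l + 1) × Fin n → K) (i : Fin (l + 1))
    (u₀ : Fin n) (hx : x (i, u₀) ≠ 0) (c' : Fin l × Fin n) :
    ∑ c, lickteigSubst K l n x i u₀ c' c * x c = 0 := by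
  classical
  simp only [lickteigSubst, sub_mul, Finset.sum_sub_distrib, ite_mul, one_mul, zero_mul,
    Finset.sum_ite_eq, Finset.sum_ite_eq', Finset.mem_univ, if_true]
  rw [div_mul_cancel₀ _ hx, sub_self]

/-- The substituted `M_⟨l+1,m,n⟩`, restricted to the `X`-rows `≠ i`, is `M_⟨l,m,n⟩` (the corrected
coordinate `(i,u₀)` of `Z` never meets an `X`-row `≠ i`). [cite: ConnerHarperLandsberg2023, §9 (p. 18)] -/
theorem lickteigSubst_matMulTensor (l m n : ℕ) (x : Fin (l + 1) × Fin n → K) (i : Fin (l + 1))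
    (u₀ : Fin n) :
    (fun (c' : Fin l × Fin n) (a : Fin l × Fin m) (b : Fin m × Fin n) =>
        ∑ c, lickteigSubst K l n x i u₀ c' c *
          matMulTensor K (l + 1) m n c ((i.succAbove a.1, a.2) : Fin (l + 1) × Fin m) b) =
      matMulTensor K l m n := by
  classical
  funext c' a b
  obtain ⟨I, u⟩ := c'
  obtain ⟨I', α⟩ := a
  obtain ⟨α', u'⟩ := b
  rw [Finset.sum_eq_single ((i.succAbove I', u') : Fin (l + 1) × Fin n)
    (fun c _ hc => by
      have : ¬(c.1 = i.succAbove I' ∧ α = α' ∧ c.2 = u') := fun h => hc (Prod.ext h.1 h.2.2)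
      simp [matMulTensor, this])
    (fun h => absurd (Finset.mem_univ _) h)]
  by_cases h1 : I = I' <;> by_cases h2 : α = α' <;> by_cases h3 : u = u' <;>
    simp [matMulTensor, lickteigSubst, h1, h2, h3, Fin.succAbove_ne]

/-- **Lickteig's increment over every field**: `bR(⟨l,m,n⟩) + 1 ≤ bR(⟨l+1,m,n⟩)` for `m, n ≥ 1`.
[cite: Lickteig1984, main result, as reproved in ConnerHarperLandsberg2023 §9 (p. 18)] -/
theorem algBorderRank_matMulTensor_succ_le (l m n : ℕ) (hm : 1 ≤ m) (hn : 1 ≤ n) :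
    algBorderRank (matMulTensor K l m n) + 1 ≤ algBorderRank (matMulTensor K (l + 1) m n) := by
  classical
  have hpos : 1 ≤ algBorderRank (matMulTensor K (l + 1) m n) := by
    have h := mul_le_algBorderRank_matMulTensor_right K (l + 1) m n
    have : 1 ≤ m * n := Nat.one_le_iff_ne_zero.2 (Nat.mul_ne_zero (by omega) (by omega))
    omega
  obtain ⟨r, hr⟩ : ∃ r, algBorderRank (matMulTensor K (l + 1) m n) = r + 1 :=
    ⟨algBorderRank (matMulTensor K (l + 1) m n) - 1, by omega⟩
  haveI : Nonempty (Fin (l + 1) × Fin n) := ⟨(0, ⟨0, by omega⟩)⟩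
  obtain ⟨x, hx, hΦ⟩ :=
    exists_algBorderRank_restrict₁_le (ι' := Fin l × Fin n) (matMulTensor K (l + 1) m n) hr
  obtain ⟨⟨i, u₀⟩, hi⟩ : ∃ c, x c ≠ 0 := by
    by_contra hc
    push Not at hc
    exact hx (funext hc)
  have key := hΦ (lickteigSubst K l n x i u₀) (lickteigSubst_apply_self K l n x i u₀ hi)
  have hres : algBorderRank (matMulTensor K l m n) ≤
      algBorderRank (fun c' a b => ∑ c, lickteigSubst K l n x i u₀ c' c *
        matMulTensor K (l + 1) m n c a b) := by
    rw [← lickteigSubst_matMulTensor K l m n x i u₀]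
    exact algBorderRank_precomp_le
      (fun c' a b => ∑ c, lickteigSubst K l n x i u₀ c' c * matMulTensor K (l + 1) m n c a b) id
      (fun a : Fin l × Fin m => ((i.succAbove a.1, a.2) : Fin (l + 1) × Fin m)) id
  omega

end MatMul

/-! ## Discharges -/

/-- **Discharge of `Lickteig1984_borderRank_matMulTensor_succ`** (`R̲(⟨l,m,n⟩) + 1 ≤ R̲(⟨l+1,m,n⟩)`,
`l, m, n ≥ 1`, over `ℂ`). [cite: Lickteig1984, main result, as reproved in ConnerHarperLandsberg2023 §9 (p. 18)] -/
theorem Lickteig1984_borderRank_matMulTensor_succ_holds : Lickteig1984_borderRank_matMulTensor_succ :=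
  fun l m n _ hm hn => algBorderRank_matMulTensor_succ_le ℂ l m n hm hn

/-- **Discharge of `Lickteig1984_borderRank_matMulTensor_2nn`** (`n² + 1 ≤ R̲(M_⟨2,n,n⟩)`, `n ≥ 2`):
the flattening bound `n·n ≤ R̲(M_⟨1,n,n⟩)` plus one increment.
[cite: Lickteig1984, as quoted in ConnerHarperLandsberg2023 §1 p. 4] -/
theorem Lickteig1984_borderRank_matMulTensor_2nn_holds : Lickteig1984_borderRank_matMulTensor_2nn := by
  intro n hn
  have h0 : n * n ≤ algBorderRank (matMulTensor ℂ 1 n n) :=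
    mul_le_algBorderRank_matMulTensor_right ℂ 1 n n
  have h1 : algBorderRank (matMulTensor ℂ 1 n n) + 1 ≤ algBorderRank (matMulTensor ℂ 2 n n) :=
    algBorderRank_matMulTensor_succ_le ℂ 1 n n (by omega) (by omega)
  rw [sq]
  omega

/-- **Discharge of `Lickteig1984_borderRank_matMulTensor_3nn`** (`n² + 2 ≤ R̲(M_⟨3,n,n⟩)`, `n ≥ 4`):
two increments from `n·n ≤ R̲(M_⟨1,n,n⟩)`. [cite: Lickteig1984, as quoted in ConnerHarperLandsberg2023 §1 p. 4] -/
theorem Lickteig1984_borderRank_matMulTensor_3nn_holds : Lickteig1984_borderRank_matMulTensor_3nn := by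
  intro n hn
  have h0 : n * n ≤ algBorderRank (matMulTensor ℂ 1 n n) :=
    mul_le_algBorderRank_matMulTensor_right ℂ 1 n n
  have h1 : algBorderRank (matMulTensor ℂ 1 n n) + 1 ≤ algBorderRank (matMulTensor ℂ 2 n n) :=
    algBorderRank_matMulTensor_succ_le ℂ 1 n n (by omega) (by omega)
  have h2 : algBorderRank (matMulTensor ℂ 2 n n) + 1 ≤ algBorderRank (matMulTensor ℂ 3 n n) :=
    algBorderRank_matMulTensor_succ_le ℂ 2 n n (by omega) (by omega)
  rw [sq]
  omega

/-- CHL 2023, Cor. 1.7 is now conditional on Thm. 1.5(3) alone (Lickteig's increment being proved).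
[cite: ConnerHarperLandsberg2023, Cor. 1.7 (arXiv), derivation from Thm. 1.5(3) and §9] -/
theorem ConnerHarperLandsberg2023_cor_1_7_of_thm_1_5 (h5 : ConnerHarperLandsberg2023_thm_1_5) :
    ConnerHarperLandsberg2023_cor_1_7 :=
  ConnerHarperLandsberg2023_cor_1_7_of h5 Lickteig1984_borderRank_matMulTensor_succ_holds

end Literature.Computability.AlgebraicComplexity

end
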